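import Literature.MathematicalPhysics.QuantumFieldTheory.Balaban1983to89.B10Thm2Exactness
import Literature.MathematicalPhysics.QuantumFieldTheory.Balaban1983to89.B10SectAGathering
import Literature.MathematicalPhysics.QuantumFieldTheory.Balaban1983to89.TreeLengthTorus

/-!
# `Balaban3D.Proofs.Bound25Sums` — [B10] p. 273 L4 «From (25), which holds for arbitrary j, we get easily |E^{(j)}| ≦
# O(1)|T₁^{(j)}|» at the term Σ_X 𝒫′_{k+1}(g_k, X, 1) of (62): the `LeafSystem` field `PprT_le` of LQB's `B10Assembly`
# for ANY carrier, from the decay (25) over LQB's cube carriers — constant displayed, `aP = C·K₀(c₀,Δ)`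

Lane «pub-balaban3d» (HOME `run/shared/lean/pub/pub-balaban3d/`), seat p5; LEAF-LEDGER row B21 (`PprT_le`, owner p5).  Kernel
bookkeeping only; no definition, no named fact; carrier-parametric over `T : B10.TowerRun`, `P : StepPieces T k`.

THE PRINTED TEXT (renders `…/1985-cmp102-uv-stability-3d-p008-x2.png`, `…-p017-x2.png`, `…-p019-x2.png` read as images).
* (25) p. 262 = PDF 8 L39–40: «|𝒫′₁(g₀, X, U₁)| ≦ O(g₀)e^{−κ𝓛(X)}, (25) where κ can be arbitrarily large if M₁ is
  sufficiently large.»; p. 270 L36–37: «The terms 𝒫′_{k+1} satisfy the bound (25) (with the indices 1, 0 replaced by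
  k + 1, k)».
* (62) p. 271 = PDF 17 L19–20: «E^{(k)} = log σ₀|T₁^{(k)*}| + d(𝔤) log g_k|T₁^{(k)*}| + log Z^{(k)}(T₁^{(k)}, 1) + Σ_X 𝒫′_{k+1}(g_k, X, 1).»
* p. 273 = PDF 19 L4: «From (25), which holds for arbitrary j, we get easily |E^{(j)}| ≦ O(1)|T₁^{(j)}|».

TARGET FIELD TYPE (LQB `B10Assembly.lean` l.286): `PprT_le : ∀ (k : ℕ) (hk : k + 1 ≤ T.K), |(steps k hk).P.PprT| ≤ C.aP *
T.sites k` («|Σ_X 𝒫′_{k+1}(g_k, X, 1)| ≤ aP|T₁^{(k)}|»).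

WHAT IS PROVED (LQB `B10Eq65PolymerSum.abs_sum_act_le_sites` — Σ_X |𝒫′(X, U)| ≤ C·g·K₀(c₀,Δ)·#blocks ≤ … ·sites —
BY NAME; nothing of it restated).
* `pprT_le_uniform_of_bound25` — if the carrier's whole-lattice vacuum sum IS `P.PprT = Σ_X 𝒫′_{k+1}(g_k, X, 1)` over an
  LQB cube system (wall-degree ≤ Δ, volume leaf c₀, κ ≥ κ₀(c₀,Δ)), with (25) at coupling `g_k ≤ 1` and `#blocks ≤ |T₁^{(k)}|`, then `|P.PprT| ≤ (C·K₀(c₀,Δ))·|T₁^{(k)}|` — the field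
  `PprT_le` with `aP = C·K₀(c₀,Δ)` (one value for the family once C, c₀, Δ are; R-CONST).
* `pprT_le_torus` — the same on LQB's concrete 3-torus block system `TreeLengthTorus.tcubeSys 3 N` (wall-degree ≤ 6,
  volume leaf c₀ = 32 and #blocks = N³ are LQB theorems): `aP = C·K₀(32, 6)`.
[cite: Balaban1985UV3, (25) p.262 + (62) p.271 + p.273]
-/

open scoped BigOperators

namespace Summit.QuantumFields.Balaban3D.Proofs

open Literature.MathematicalPhysics.QuantumFieldTheory.Balaban1983to89
open Literature.MathematicalPhysics.QuantumFieldTheory.Balaban1983to89.B10 (TowerRun)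
open Literature.MathematicalPhysics.QuantumFieldTheory.Balaban1983to89.B10SectAGathering (StepPieces)
open Literature.MathematicalPhysics.QuantumFieldTheory.Balaban1983to89.B12TreeDecay (CubeSystem kappa₀ K₀ K₀_pos)

variable {S : LocDomainSys} (G : CubeSystem S) {Δ : ℕ} {c₀ κ C : ℝ} {T : TowerRun} {k : ℕ}

/-- **`LeafSystem.PprT_le` for ANY carrier, k-UNIFORM constant** (p. 273 L4 «From (25) … we get easily |E^{(j)}| ≦
O(1)|T₁^{(j)}|» at the last term of (62)): if `P.PprT = Σ_X 𝒫′_{k+1}(g_k, X, 1)` over an LQB cube system of the scale-k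
big blocks (wall-degree ≤ Δ, volume leaf c₀, `κ ≥ κ₀(c₀,Δ)`), (25) holds at coupling `g_k` with `0 ≤ C`, `0 ≤ g_k ≤ 1`,
and `#blocks ≤ |T₁^{(k)}|`, then `|P.PprT| ≤ (C·K₀(c₀,Δ))·|T₁^{(k)}|` — LQB `B10Eq65PolymerSum.abs_sum_act_le_sites`
(constant `C·g_k·K₀`) with the running coupling majorised by 1 (R-EPS0), so that ONE `aP` serves every k and every run
(R-CONST). [cite: Balaban1985UV3, (62) p.271 + p.273] -/
theorem pprT_le_uniform_of_bound25 (P : StepPieces T k) (hΔ : G.DegreeLE Δ) (hV : G.VolumeLeaf c₀)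
    (hκ : kappa₀ c₀ Δ ≤ κ) (act : S.Dom → T.Cfg (k + 1) → ℝ) (U₁ : T.Cfg (k + 1)) (hC : 0 ≤ C) (hg : 0 ≤ T.g k)
    (hg1 : T.g k ≤ 1) (h25 : B10.Bound25Printed ⟨S.Dom, T.Cfg (k + 1), S.dj, act⟩ (T.g k) κ C)
    (hPprT : P.PprT = ∑ X : S.Dom, act X U₁) (hblocks : (Fintype.card G.Cube : ℝ) ≤ T.sites k) :
    |P.PprT| ≤ (C * K₀ c₀ Δ) * T.sites k := by
  have h1 := B10Eq65PolymerSum.abs_sum_act_le_sites G hΔ hV hκ act (mul_nonneg hC hg) h25 U₁ hblocks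
  rw [hPprT]
  refine h1.trans ?_
  have hsites : 0 ≤ T.sites k := (Nat.cast_nonneg _).trans hblocks
  have hK := (K₀_pos c₀ Δ).le
  have h2 : C * T.g k * K₀ c₀ Δ ≤ C * K₀ c₀ Δ := by
    calc C * T.g k * K₀ c₀ Δ ≤ C * 1 * K₀ c₀ Δ :=
          mul_le_mul_of_nonneg_right (mul_le_mul_of_nonneg_left hg1 hC) hK
      _ = C * K₀ c₀ Δ := by ring
  exact mul_le_mul_of_nonneg_right h2 hsites

/-- **`PprT_le` on the 3-torus block carrier** (`tcubeSys 3 N`: N big blocks per direction; `tdegreeLE`, `tvolumeLeaf`,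
`card_tcube` discharge the carrier leaves): (25) at coupling `g_k ≤ 1` with `κ ≥ κ₀(32,6)`, `PprT = Σ_X 𝒫′(X, 1)` and
`N³ ≤ |T₁^{(k)}|` give `|P.PprT| ≤ (C·K₀(32,6))·|T₁^{(k)}|`. [cite: Balaban1985UV3, (62) p.271 + p.273] -/
theorem pprT_le_torus (N : ℕ) [NeZero N] (P : StepPieces T k)
    (hκ : kappa₀ (4 * 2 ^ 3) (2 * 3) ≤ κ)
    (act : (TreeLengthTorus.tsys 3 N).Dom → T.Cfg (k + 1) → ℝ) (U₁ : T.Cfg (k + 1))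
    (hC : 0 ≤ C) (hg : 0 ≤ T.g k) (hg1 : T.g k ≤ 1)
    (h25 : B10.Bound25Printed
      ⟨(TreeLengthTorus.tsys 3 N).Dom, T.Cfg (k + 1), (TreeLengthTorus.tsys 3 N).dj, act⟩ (T.g k) κ C)
    (hPprT : P.PprT = ∑ X : (TreeLengthTorus.tsys 3 N).Dom, act X U₁) (hblocks : ((N : ℝ) ^ 3) ≤ T.sites k) :
    |P.PprT| ≤ (C * K₀ (4 * 2 ^ 3) (2 * 3)) * T.sites k := by
  have hcard : (Fintype.card (TreeLengthTorus.tcubeSys 3 N).Cube : ℝ) = (N : ℝ) ^ 3 := by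
    rw [TreeLengthTorus.card_tcube]; push_cast; rfl
  refine pprT_le_uniform_of_bound25 (TreeLengthTorus.tcubeSys 3 N) P (TreeLengthTorus.tdegreeLE 3 N)
    (TreeLengthTorus.tvolumeLeaf 3 N) hκ act U₁ hC hg hg1 h25 hPprT ?_
  rwa [hcard]

end Summit.QuantumFields.Balaban3D.Proofs
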